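import Literature.NumberTheory.EllipticCurves.Kramer1981.UnramifiedTwistNormGroupProofs
import Literature.NumberTheory.DiophantineGeometry.TateAlgorithmProofs
import HarnessLib

/-!
# Kramer 1981, §2 Proposition 2 (a): the twisted Tate curve over an unramified quadratic
# extension — discharge of `props1_2a_multiplicativeNormIndex`

Kenneth Kramer, *Arithmetic of elliptic curves upon quadratic extension*, Trans. Amer. Math.
Soc. 264 (1981), 121–135, §2, Proposition 2 (p. 123): "Suppose that `E` is a twisted Tate curve,
twisted by the unramified quadratic extension `L`. (a) If `K` is unramified over `F`, then
`i(K/F)` is `0` or `1` according to whether `v(Δ)` is odd or even."  Kramer's proof (p. 123):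
"If `E` is twisted by the quadratic extension `L`, then `E` becomes isomorphic to `G_m/q^ℤ` over
any field containing `L` … the norm mapping on `E` corresponds to field-theoretic norm modulo
`q^ℤ`", with the Galois action twisted by the quadratic character of `L/F`.

This file (theorems only; no new definitions or named facts) follows that proof for `F` a
non-archimedean local field of characteristic `0`:

* §1 `variableChange_eq_one_or_eq_neg`: `Aut` of a Weierstrass equation with `j ≠ 0, 1728` is
  `{1, [-1]}`, `[-1] = (u, r, s, t) = (-1, 0, -a₁, -a₃)` (Silverman AEC III.10.1);
  `map_algEquiv_eq_or`: a `K'`-isomorphism `C : E_{K'} ⥲ X_{K'}` of curves over `F` has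
  `C^σ = C` or `C^σ = [-1] ∘ C` (AEC X.2.2, the cocycle of a twist), and in the first case
  descends to `F`; `map_pointInv_eq_pointInv_neg_map`: if `C^σ = [-1] ∘ C` the induced bijection
  `ψ : X(K') → E(K')` satisfies `σ(ψ P) = ψ(-σP)`.
* §2 `exists_twistedUniformizer`: for `E` with `|j| > 1`, NON-split minimal model, Tate parameter
  `q`, and a quadratic `K' = F(x)` over which `γ(E/F)` is a square: a surjective homomorphism
  `f : K'^× → E(K')` with kernel `q^ℤ` and `σ · f(u) = -f(σu)` (tree: discharged Tate
  uniformisation `TateCurve.uniformization_holds`, the `K'`-rational engine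
  `exists_uniformizer_intermediateField`, Silverman ATAEC V.5.2 (b)
  `exists_variableChange_of_j_eq_of_isSquare_gamma`; `C^σ = C` is excluded since `E ≅_F E_q`
  would make the minimal model split).
* §3 `ord_tateParameter_eq_ord_Δ`, `ord_Δ_eq_of_kodairaSymbol_eq_I`: `v(q) = v(Δ_min)` and
  Kodaira type `I_v` means `v = v(Δ_min) ≥ 1` (AEC VII.5.1 (b); ATAEC IV.9.4 step 2).
* §4 Hilbert 90 for `K'/F`; `E(K')^σ = f({u : u·σu ∈ q^ℤ})` (Kramer's `I(M)`),
  `N E(K') = f({w/σw})`; the dichotomy `f(u) ∈ N E(K') ↔ n even` for `u·σu = q^n`; hence the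
  index is `1` if only even `n` occur and `2` if `q` is a norm.
* §5 `prop2a_unramifiedNormIndex` (clause (2) of the fact, using the unramified inputs of
  `UnramifiedTwistNormGroupProofs`: `γ ∈ K'^{×2}` and `N K'^× = {2 ∣ ord}`), and the discharge
  `props1_2a_multiplicativeNormIndex_holds` (clause (1) is `prop1_splitMultiplicativeNormIndex`).

## References
* [cite: Kramer1981, §2 Props. 1 and 2 (a) (p. 123)]
* [cite: SilvermanAEC2009, Thm. III.10.1 and Thm. X.2.2]
* [cite: SilvermanATAEC1994, Thm. V.5.3 and IV.9.4]
* [cite: SerreLocalFields1979, Ch. X §1 Prop. 2 (Hilbert 90)]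
-/

noncomputable section

open scoped Classical

open ValuativeRel Field WeierstrassCurve
open Literature.NumberTheory.GaloisRepresentations
open Literature.NumberTheory.GaloisRepresentations.IsNonarchimedeanLocalField
open Literature.NumberTheory.EllipticCurves.TateCurve
open Literature.NumberTheory.EllipticCurves.SteinWuthrich2013
open Literature.NumberTheory.QuadraticForms
open Literature.NumberTheory.EllipticCurves.KramerTunnell1982

namespace Literature.NumberTheory.EllipticCurves.Kramer1981

universe u

/-! ## §1 Automorphisms `±1` and the Galois behaviour of a `K'`-isomorphism -/

section Aut

variable {K : Type*} [Field K] [CharZero K]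

/-- **The automorphism group of a Weierstrass equation with `j ≠ 0, 1728` is `{±1}`**
(Silverman AEC III.10.1: `Aut(E) = μ₂`; explicitly, `D • W = W` forces `u⁴ = u⁶ = 1` from
`c₄, c₆ ≠ 0`, then `(r, s, t) = (0, 0, 0)` or `(0, -a₁, -a₃)`).
[cite: SilvermanAEC2009, Thm. III.10.1] -/
theorem variableChange_eq_one_or_eq_neg (W : WeierstrassCurve K) [W.IsElliptic] (h0 : W.j ≠ 0)
    (h1728 : W.j ≠ 1728) (D : VariableChange K) (hD : D • W = W) :
    D = 1 ∨ D = ⟨-1, 0, -W.a₁, -W.a₃⟩ := by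
  have hΔ0 : W.Δ ≠ 0 := W.isUnit_Δ.ne_zero
  have hc4 : W.c₄ ≠ 0 := fun h => h0 (W.j_eq_zero h)
  have hc6 : W.c₆ ≠ 0 := by
    intro h6
    apply h1728
    have hrel := W.c_relation
    rw [h6, zero_pow two_ne_zero, sub_zero] at hrel
    rw [j, Units.val_inv_eq_inv_val, coe_Δ', inv_mul_eq_iff_eq_mul₀ hΔ0, ← hrel, mul_comm]
  obtain ⟨u, r, s, t⟩ := D
  have e4 := congrArg WeierstrassCurve.c₄ hD
  have e6 := congrArg WeierstrassCurve.c₆ hD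
  have ea1 := congrArg WeierstrassCurve.a₁ hD
  have ea2 := congrArg WeierstrassCurve.a₂ hD
  have ea3 := congrArg WeierstrassCurve.a₃ hD
  simp only [variableChange_c₄, variableChange_c₆, variableChange_a₁, variableChange_a₂,
    variableChange_a₃] at e4 e6 ea1 ea2 ea3
  set w : K := ((u⁻¹ : Kˣ) : K) with hw
  have hw4 : w ^ 4 = 1 := mul_right_cancel₀ hc4 (e4.trans (one_mul _).symm)
  have hw6 : w ^ 6 = 1 := mul_right_cancel₀ hc6 (e6.trans (one_mul _).symm)
  have hw2 : w * w = 1 := by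
    have : w ^ 6 = w ^ 4 * (w * w) := by ring
    rw [hw6, hw4, one_mul] at this
    exact this.symm
  rcases mul_self_eq_one_iff.mp hw2 with h1 | h1
  · -- `u = 1`
    left
    have hu : u = 1 := by
      have : u⁻¹ = 1 := Units.ext h1
      simpa using this
    rw [h1] at ea1 ea2 ea3
    have hs : s = 0 := by
      have : (2 : K) * s = 0 := by linear_combination ea1
      simpa using this
    have hr : r = 0 := by
      have : (3 : K) * r = 0 := by rw [hs] at ea2; linear_combination ea2
      simpa using this
    have ht : t = 0 := by
      have : (2 : K) * t = 0 := by rw [hr] at ea3; linear_combination ea3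
      simpa using this
    subst hu hs hr ht
    rfl
  · -- `u = -1`
    right
    have hu : u = -1 := by
      have : u⁻¹ = -1 := Units.ext h1
      rw [inv_eq_iff_eq_inv] at this
      rw [this]; simp
    rw [h1] at ea1 ea2 ea3
    have hs : s = -W.a₁ := by
      have : (2 : K) * (s + W.a₁) = 0 := by linear_combination -ea1
      have : s + W.a₁ = 0 := by simpa using this
      linear_combination this
    have hr : r = 0 := by
      have : (3 : K) * r = 0 := by rw [hs] at ea2; linear_combination ea2
      simpa using this
    have ht : t = -W.a₃ := by
      have : (2 : K) * (t + W.a₃) = 0 := by rw [hr] at ea3; linear_combination -ea3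
      have : t + W.a₃ = 0 := by simpa using this
      linear_combination this
    subst hu hs hr ht
    rfl

end Aut

section Twist

variable {F : Type u} [Field F] [CharZero F] {K' : IntermediateField F (AlgebraicClosure F)}

omit [CharZero F] in
/-- `(C • E_{K'})^σ = C^σ • E_{K'}` for `E` defined over `F`. [folklore] -/
private theorem map_smul_baseChange (σ : K' ≃ₐ[F] K') (C : VariableChange K') (E : WeierstrassCurve F) :
    (C • E.baseChange K').map ((σ : K' →ₐ[F] K') : K' →+* K') =
      C.map ((σ : K' →ₐ[F] K') : K' →+* K') • E.baseChange K' := by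
  rw [← map_variableChange, map_baseChange]

omit [CharZero F] in
/-- `E_{K'}` is an elliptic curve (instance through the `def` `baseChange`). [folklore] -/
private theorem isElliptic_baseChange (X : WeierstrassCurve F) [X.IsElliptic] :
    (X.baseChange K').IsElliptic :=
  (inferInstance : (X.map (algebraMap F K')).IsElliptic)

omit [CharZero F] in
/-- `j(E_{K'}) = j(E)`. [folklore] -/
private theorem j_baseChange (X : WeierstrassCurve F) [X.IsElliptic] :
    haveI := isElliptic_baseChange (K' := K') X
    (X.baseChange K').j = algebraMap F K' X.j :=
  X.map_j (algebraMap F K')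

omit [CharZero F] in
/-- `c₄(E_{K'}) = c₄(E)`. [folklore] -/
private theorem c₄_baseChange (X : WeierstrassCurve F) : (X.baseChange K').c₄ = algebraMap F K' X.c₄ :=
  X.map_c₄ (algebraMap F K')

omit [CharZero F] in
/-- `c₆(E_{K'}) = c₆(E)`. [folklore] -/
private theorem c₆_baseChange (X : WeierstrassCurve F) : (X.baseChange K').c₆ = algebraMap F K' X.c₆ :=
  X.map_c₆ (algebraMap F K')

/-- **The `K'`-isomorphism `E ≅ X` is Galois-equivariant up to an automorphism of `X`**: for
`C • E_{K'} = X_{K'}` with `E, X` over `F` and `j(X) ≠ 0, 1728`, `C^σ C⁻¹ ∈ Aut(X_{K'}) = {±1}`,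
i.e. `C^σ = C` or `C^σ = [-1] ∘ C`. [cite: SilvermanAEC2009, Thm. III.10.1 and X.2.2 (a)] -/
theorem map_algEquiv_eq_or (E X : WeierstrassCurve F) [X.IsElliptic] (h0 : X.j ≠ 0)
    (h1728 : X.j ≠ 1728) (σ : K' ≃ₐ[F] K') (C : VariableChange K')
    (hC : C • E.baseChange K' = X.baseChange K') :
    C.map ((σ : K' →ₐ[F] K') : K' →+* K') = C ∨
      C.map ((σ : K' →ₐ[F] K') : K' →+* K') =
        ⟨-1, 0, -(X.baseChange K').a₁, -(X.baseChange K').a₃⟩ * C := by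
  haveI := isElliptic_baseChange (K' := K') X
  set D := C.map ((σ : K' →ₐ[F] K') : K' →+* K') * C⁻¹ with hDdef
  have hD : D • X.baseChange K' = X.baseChange K' := by
    rw [hDdef, mul_smul, ← hC, inv_smul_smul, ← map_smul_baseChange, hC, map_baseChange]
  have hjX : (X.baseChange K').j = algebraMap F K' X.j := j_baseChange X
  have h0' : (X.baseChange K').j ≠ 0 := by
    rw [hjX]; exact (_root_.map_ne_zero _).mpr h0
  have h1728' : (X.baseChange K').j ≠ 1728 := by
    rw [hjX]
    intro h
    exact h1728 ((algebraMap F K').injective (h.trans (map_ofNat (algebraMap F K') 1728).symm))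
  have hCD : C.map ((σ : K' →ₐ[F] K') : K' →+* K') = D * C := by
    rw [hDdef, inv_mul_cancel_right]
  rcases variableChange_eq_one_or_eq_neg (X.baseChange K') h0' h1728' D hD with h | h
  · left; rw [hCD, h, one_mul]
  · right; rw [hCD, h]

/-- **Galois descent of a `σ`-invariant change of variables** over the quadratic `K' = F(x)`:
`C^σ = C` forces `C = C₀ ⊗ K'` with `C₀` defined over `F`. [folklore] -/
private theorem exists_eq_baseChange_of_map_algEquiv_eq (h2 : Module.finrank F K' = 2) {d : F}
    (hd : ¬ IsSquare d) {x : K'} (hx : x ^ 2 = algebraMap F K' d) {σ : K' ≃ₐ[F] K'} (hσ : σ ≠ 1)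
    {C : VariableChange K'} (hC : C.map ((σ : K' →ₐ[F] K') : K' →+* K') = C) :
    ∃ C₀ : VariableChange F, C₀.map (algebraMap F K') = C := by
  obtain ⟨u, r, s, t⟩ := C
  have hu := congrArg (fun D : VariableChange K' => (D.u : K')) hC
  have hr := congrArg VariableChange.r hC
  have hs := congrArg VariableChange.s hC
  have ht := congrArg VariableChange.t hC
  simp only [VariableChange.map, Units.coe_map, MonoidHom.coe_coe, RingHom.coe_coe,
    AlgEquiv.coe_toAlgHom] at hu hr hs ht
  obtain ⟨a, ha⟩ := exists_eq_algebraMap_of_fixed h2 hd hx hσ hu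
  obtain ⟨r₀, hr₀⟩ := exists_eq_algebraMap_of_fixed h2 hd hx hσ hr
  obtain ⟨s₀, hs₀⟩ := exists_eq_algebraMap_of_fixed h2 hd hx hσ hs
  obtain ⟨t₀, ht₀⟩ := exists_eq_algebraMap_of_fixed h2 hd hx hσ ht
  have ha0 : a ≠ 0 := by
    rintro rfl
    rw [map_zero] at ha
    exact u.ne_zero ha
  refine ⟨⟨Units.mk0 a ha0, r₀, s₀, t₀⟩, ?_⟩
  simp only [VariableChange.map, VariableChange.mk.injEq]
  refine ⟨Units.ext ?_, hr₀.symm, hs₀.symm, ht₀.symm⟩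
  rw [Units.coe_map, MonoidHom.coe_coe, Units.val_mk0, ← ha]

omit [CharZero F] in
/-- Components of `C^σ = [-1] ∘ C`: `σu = -u`, `σr = r`, `σs = s - u a₁'`, `σt = t - u³ a₃'`. [folklore] -/
private theorem components_of_map_algEquiv_eq_neg {X' : WeierstrassCurve K'} {σ : K' ≃ₐ[F] K'}
    {C : VariableChange K'}
    (h : C.map ((σ : K' →ₐ[F] K') : K' →+* K') = ⟨-1, 0, -X'.a₁, -X'.a₃⟩ * C) :
    σ (C.u : K') = -(C.u : K') ∧ σ C.r = C.r ∧ σ C.s = C.s - C.u * X'.a₁ ∧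
      σ C.t = C.t - (C.u : K') ^ 3 * X'.a₃ := by
  have hu := congrArg (fun D : VariableChange K' => (D.u : K')) h
  have hr := congrArg VariableChange.r h
  have hs := congrArg VariableChange.s h
  have ht := congrArg VariableChange.t h
  simp only [VariableChange.map, VariableChange.mul_def, Units.coe_map, MonoidHom.coe_coe,
    RingHom.coe_coe, AlgEquiv.coe_toAlgHom, Units.val_mul, Units.val_neg, Units.val_one]
    at hu hr hs ht
  refine ⟨by rw [hu]; ring, by rw [hr]; ring, by rw [hs]; ring, by rw [ht]; ring⟩

/-- **The twisted Galois action through a `K'`-isomorphism with `C^σ = [-1] ∘ C`**: for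
`P ∈ X(K')`, `σ(ψ P) = ψ(-σP)` where `ψ : X(K') → E(K')` is the inverse substitution of `C`
(Silverman AEC X.2.2: the cocycle `σ ↦ C^σ C⁻¹ = [-1]` of the quadratic twist).
[cite: SilvermanAEC2009, Thm. X.2.2 (a),(c)] -/
theorem map_pointInv_eq_pointInv_neg_map (E X : WeierstrassCurve F) (σ : K' ≃ₐ[F] K')
    (C : VariableChange K') (hC : C • E.baseChange K' = X.baseChange K')
    (hσC : C.map ((σ : K' →ₐ[F] K') : K' →+* K') =
      ⟨-1, 0, -(X.baseChange K').a₁, -(X.baseChange K').a₃⟩ * C)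
    (P : (X.baseChange K').toAffine.Point) :
    Affine.Point.map (W' := E) (σ : K' →ₐ[F] K')
        (VariableChange.pointInv (E.baseChange K') C (Affine.Point.congrEquiv hC.symm P)) =
      VariableChange.pointInv (E.baseChange K') C
        (Affine.Point.congrEquiv hC.symm (-(Affine.Point.map (W' := X) (σ : K' →ₐ[F] K') P))) := by
  obtain ⟨hu, hr, hs, ht⟩ := components_of_map_algEquiv_eq_neg hσC
  rcases P with _ | ⟨x, y, h⟩
  · simp only [← Affine.Point.zero_def, map_zero, neg_zero, VariableChange.pointInv_zero]
  · rw [Affine.Point.map_some, Affine.Point.neg_some, Affine.Point.congrEquiv_some,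
      Affine.Point.congrEquiv_some, VariableChange.pointInv_some, VariableChange.pointInv_some,
      Affine.Point.map_some]
    simp only [Affine.Point.some.injEq, VariableChange.ofX_def, VariableChange.ofY_def,
      AlgEquiv.coe_toAlgHom, map_add, map_mul, map_pow, hu, hr, hs, ht, Affine.negY]
    constructor
    · ring
    · ring

end Twist

/-! ## §2 The twisted uniformisation -/

section Local

variable {F : Type} [Field F] [ValuativeRel F] [TopologicalSpace F] [IsNonarchimedeanLocalField F]
  [CharZero F]

omit [CharZero F] in
/-- `‖x‖ ≤ 1 ↔ x ∈ 𝒪[F]` in range form. [folklore] -/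
private theorem norm_le_one_iff_mem_range'' :
    letI := nontriviallyNormedField F
    ∀ x : F, ‖x‖ ≤ 1 ↔ x ∈ Set.range (algebraMap 𝒪[F] F) := by
  letI := nontriviallyNormedField F
  intro x
  rw [norm_le_one_iff F x]
  constructor
  · intro hx; exact ⟨⟨x, hx⟩, rfl⟩
  · rintro ⟨y, rfl⟩; exact y.2

/-- **An `F`-isomorphism `E ≅ E_q` makes the minimal model split multiplicative** (the Tate curve
has split multiplicative reduction, ATAEC V.5.3 proof; split-ness is shared by all minimal models,
AEC VII.1.3 (b)). [cite: SilvermanATAEC1994, Thm. V.5.3 (b) (PDF pp. 407–408)] -/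
theorem hasSplitMultiplicativeReduction_minimal_of_smul_eq_tateCurve (E : WeierstrassCurve F)
    [E.IsElliptic] {q : F} (hq : letI := nontriviallyNormedField F; ‖q‖ < 1)
    (C : VariableChange F) (hC : letI := nontriviallyNormedField F; C • E = tateCurve q) :
    (E.minimal 𝒪[F]).HasSplitMultiplicativeReduction 𝒪[F] := by
  letI := nontriviallyNormedField F
  have hsplit : (C • E).HasSplitMultiplicativeReduction 𝒪[F] := by
    rw [hC]; exact tateCurve_hasSplitMultiplicativeReduction 𝒪[F] norm_le_one_iff_mem_range'' hq
  haveI : (C • E).IsMinimal 𝒪[F] := hsplit.toIsMinimal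
  have hrel : E.minimal 𝒪[F] = ((E.exists_isMinimal 𝒪[F]).choose * C⁻¹) • (C • E) := by
    rw [← mul_smul, inv_mul_cancel_right]; rfl
  exact (hasSplitMultiplicativeReduction_iff_of_isMinimal_of_eq_smul 𝒪[F] hrel
    (C • E).isUnit_Δ.ne_zero).mpr hsplit

/-- **The twisted Tate uniformisation of `E(K')`** (Kramer 1981 §2, p. 123: "`E` becomes
isomorphic to `G_m/q^ℤ` over any field containing `L`", with the Galois action twisted by the
quadratic character — Silverman AEC X.2.2 / ATAEC V.5.3): for `E/F` with `|j(E)| > 1` whose minimal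
model is not split multiplicative, a Tate parameter `q` with `j(E_q) = j(E)`, and a quadratic
`K' = F(x)`, `x² = d`, `Gal(K'/F) = ⟨σ⟩`, over which `γ(E/F)` is a square, there is a surjective
homomorphism `f : K'^× → E(K')` with kernel `q^ℤ` and `σ·f(u) = -f(σu)`.
[cite: Kramer1981, §2 Prop. 2 (p. 123)] -/
theorem exists_twistedUniformizer (E : WeierstrassCurve F) [E.IsElliptic]
    (hns : ¬ (E.minimal 𝒪[F]).HasSplitMultiplicativeReduction 𝒪[F])
    (hj : letI := nontriviallyNormedField F; 1 < ‖E.j‖) {q : F} (hq0 : q ≠ 0)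
    (hq : letI := nontriviallyNormedField F; ‖q‖ < 1)
    (hqj : letI := nontriviallyNormedField F; tateJ q = E.j)
    (K' : IntermediateField F (AlgebraicClosure F)) (h2 : Module.finrank F K' = 2)
    (σ : K' ≃ₐ[F] K') (hσ : σ ≠ 1) {d : F} (hd : ¬ IsSquare d) {x : K'}
    (hx : x ^ 2 = algebraMap F K' d) (hγ : IsSquare (algebraMap F K' (-(E.c₄ / E.c₆)))) :
    ∃ f : Additive (↥K')ˣ →+ (E.baseChange K').toAffine.Point,
      Function.Surjective f ∧
      (∀ u : (↥K')ˣ, f (Additive.ofMul u) = 0 ↔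
          ∃ n : ℤ, ((u : K') : K') = algebraMap F K' q ^ n) ∧
      (∀ u : (↥K')ˣ, Affine.Point.map (W' := E) (σ : K' →ₐ[F] K') (f (Additive.ofMul u)) =
          -f (Additive.ofMul (Units.map (σ : K' →* K') u))) := by
  letI := nontriviallyNormedField F
  haveI hEq : (tateCurve q).IsElliptic := tateCurve_isElliptic hq0 hq
  haveI := isElliptic_baseChange (K' := K') E
  haveI := isElliptic_baseChange (K' := K') (tateCurve q)
  -- the uniformisation of `E_q` over `K'`
  obtain ⟨φ, -, hφk, hφe, hφd⟩ := uniformization_holds q hq0 hq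
  obtain ⟨g, -, hgs, hgk, hge⟩ := exists_uniformizer_intermediateField (tateCurve q) q φ hφk
    (fun τ u => hφe ((absoluteGaloisGroup.toAlgEquiv F).symm τ) u)
    (fun L P hP => hφd L P fun σ hσ => hP (absoluteGaloisGroup.toAlgEquiv F σ) hσ) K'
  -- the `K'`-isomorphism `E ≅ E_q`
  obtain ⟨h0, h1728⟩ := j_ne_zero_and_ne_1728_of_one_lt_norm hj
  have hjq : (tateCurve q).j = E.j := by rw [tateCurve_j hq, hqj]
  have heq : (E.baseChange K').j = ((tateCurve q).baseChange K').j := by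
    rw [j_baseChange, j_baseChange, hjq]
  have h0' : (E.baseChange K').j ≠ 0 := by
    rw [j_baseChange]; exact (_root_.map_ne_zero _).mpr h0
  have h1728' : (E.baseChange K').j ≠ 1728 := by
    rw [j_baseChange]
    intro h
    exact h1728 ((algebraMap F K').injective (h.trans (map_ofNat (algebraMap F K') 1728).symm))
  have hγ' : IsSquare (-((E.baseChange K').c₄ / (E.baseChange K').c₆)) := by
    rw [c₄_baseChange, c₆_baseChange, ← map_div₀, ← map_neg]; exact hγ
  have hγq : IsSquare (-(((tateCurve q).baseChange K').c₄ / ((tateCurve q).baseChange K').c₆)) := by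
    rw [c₄_baseChange, c₆_baseChange, ← map_div₀, ← map_neg]
    exact (isSquare_gamma_tateCurve hq (by norm_num)).map (algebraMap F K')
  obtain ⟨C, hC⟩ := exists_variableChange_of_j_eq_of_isSquare_gamma (E.baseChange K')
    ((tateCurve q).baseChange K') heq h0' h1728' hγ' hγq
  -- `C^σ = [-1] ∘ C`: otherwise `C` descends to `F` and `E` would be split multiplicative
  have hσC : C.map ((σ : K' →ₐ[F] K') : K' →+* K') =
      ⟨-1, 0, -((tateCurve q).baseChange K').a₁, -((tateCurve q).baseChange K').a₃⟩ * C := by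
    rcases map_algEquiv_eq_or E (tateCurve q) (hjq ▸ h0) (hjq ▸ h1728) σ C hC with h | h
    · exfalso
      obtain ⟨C₀, hC₀⟩ := exists_eq_baseChange_of_map_algEquiv_eq h2 hd hx hσ h
      apply hns
      refine hasSplitMultiplicativeReduction_minimal_of_smul_eq_tateCurve E hq C₀ ?_
      apply WeierstrassCurve.map_injective (algebraMap F K').injective
      change (C₀ • E).baseChange K' = (tateCurve q).baseChange K'
      rw [VariableChange.baseChange_smul_eq, hC₀, hC]
    · exact h
  -- the twisted uniformizer
  set ψ : ((tateCurve q).baseChange K').toAffine.Point →+ (E.baseChange K').toAffine.Point :=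
    ((VariableChange.pointEquiv (E.baseChange K') C).symm.toAddMonoidHom).comp
      (Affine.Point.congrEquiv hC.symm).toAddMonoidHom with hψdef
  have hψ : ∀ P, ψ P = VariableChange.pointInv (E.baseChange K') C
      (Affine.Point.congrEquiv hC.symm P) := fun P => rfl
  have hψinj : Function.Injective ψ :=
    (VariableChange.pointEquiv (E.baseChange K') C).symm.injective.comp
      (Affine.Point.congrEquiv hC.symm).injective
  have hψsurj : Function.Surjective ψ :=
    (VariableChange.pointEquiv (E.baseChange K') C).symm.surjective.comp
      (Affine.Point.congrEquiv hC.symm).surjective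
  refine ⟨ψ.comp g, hψsurj.comp hgs, fun u => ?_, fun u => ?_⟩
  · rw [AddMonoidHom.comp_apply, ← hgk u]
    constructor
    · intro h; exact hψinj (h.trans (map_zero ψ).symm)
    · intro h; rw [h, map_zero]
  · show Affine.Point.map (W' := E) (σ : K' →ₐ[F] K') (ψ (g (Additive.ofMul u))) =
      -ψ (g (Additive.ofMul (Units.map (σ : K' →* K') u)))
    rw [hψ (g _), map_pointInv_eq_pointInv_neg_map E (tateCurve q) σ C hC hσC, ← hge σ u, ← hψ,
      map_neg]

end Local

/-! ## §3 `v(q) = v(Δ_min)` and the Kodaira type `I_v` -/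

section Valuation

open LocalWeilDatum

variable {F : Type} [Field F] [ValuativeRel F] [TopologicalSpace F] [IsNonarchimedeanLocalField F]

/-- `ord (t⁻¹) = - ord t`. [folklore] -/
private theorem ord_inv'' {t : F} (ht : t ≠ 0) : ord F t⁻¹ = -ord F t := by
  have h := ord_mul F (inv_ne_zero ht) ht
  rw [inv_mul_cancel₀ ht, ord_one] at h
  omega

/-- `ord u = 0` for a unit `u` of `𝒪[F]`. [folklore] -/
private theorem ord_eq_zero_of_not_mem {a : 𝒪[F]} (ha : a ∉ 𝓂[F]) : ord F (a : F) = 0 := by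
  have hu : IsUnit a := by
    by_contra h; exact ha ((IsLocalRing.mem_maximalIdeal a).mpr h)
  have hv : valuation F (a : F) = 1 :=
    (Valuation.integer.integers (valuation F)).isUnit_iff_valuation_eq_one.mp hu
  have ha0 : (a : F) ≠ 0 := fun h0 => by rw [h0, map_zero] at hv; exact zero_ne_one hv
  exact (ord_eq_zero_iff F ha0).mpr hv

/-- `ord (u ϖⁿ) = n`. [folklore] -/
private theorem ord_coe_eq_of_eq_unit_mul_pow {a : 𝒪[F]} {ϖ : 𝒪[F]} (hϖ : Irreducible ϖ) (u : 𝒪[F]ˣ)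
    {n : ℕ} (ha : a = u * ϖ ^ n) : ord F (a : F) = n := by
  have hϖ0 : (ϖ : F) ≠ 0 := fun h0 => hϖ.ne_zero (Subtype.ext h0)
  have hu0 : ((u : 𝒪[F]) : F) ≠ 0 := fun h0 => u.ne_zero (Subtype.ext h0)
  have hu : ord F ((u : 𝒪[F]) : F) = 0 :=
    ord_eq_zero_of_not_mem fun h => (IsLocalRing.mem_maximalIdeal _).mp h u.isUnit
  rw [ha]
  push_cast
  rw [ord_mul F hu0 (pow_ne_zero n hϖ0), hu, ord_pow F hϖ0, ord_eq_one_of_irreducible F hϖ]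
  ring

/-- **`v(q) = v(Δ_min)`** for a Tate parameter `q` of `E` (`|q| = |j(E)|⁻¹`) when the minimal model
has multiplicative reduction (`c₄` of the minimal model is a unit, `j = c₄³/Δ`; Silverman AEC
VII.5.1 (b)). [cite: SilvermanAEC2009, Prop. VII.5.1 (b)] -/
theorem ord_tateParameter_eq_ord_Δ (E : WeierstrassCurve F) [E.IsElliptic]
    (hmult : (E.minimal 𝒪[F]).HasMultiplicativeReduction 𝒪[F]) {q : F} (hq0 : q ≠ 0)
    (hqn : letI := nontriviallyNormedField F; ‖q‖ = ‖E.j‖⁻¹) :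
    ord F q = ord F (E.minimal 𝒪[F]).Δ := by
  letI := nontriviallyNormedField F
  haveI : (E.minimal 𝒪[F]).IsMinimal 𝒪[F] := hmult.toIsMinimal
  haveI hWe : (E.minimal 𝒪[F]).IsElliptic := by
    change ((E.exists_isMinimal 𝒪[F]).choose • E).IsElliptic; infer_instance
  have hc4 : ((E.minimal 𝒪[F]).integralModel 𝒪[F]).c₄ ∉ 𝓂[F] := by
    have h := hmult.multiplicativeReduction
    rw [← integralModel_c₄_eq 𝒪[F] (E.minimal 𝒪[F]),
      IsDedekindDomain.HeightOneSpectrum.valuation_eq_one_iff_notMem] at h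
    exact h
  have hWc₄ : (E.minimal 𝒪[F]).c₄ =
      algebraMap 𝒪[F] F ((E.minimal 𝒪[F]).integralModel 𝒪[F]).c₄ :=
    (integralModel_c₄_eq 𝒪[F] (E.minimal 𝒪[F])).symm
  have hΔ0 : (E.minimal 𝒪[F]).Δ ≠ 0 := (E.minimal 𝒪[F]).isUnit_Δ.ne_zero
  have hc40 : (E.minimal 𝒪[F]).c₄ ≠ 0 := by
    rw [hWc₄]
    intro h0
    apply hc4
    rw [show ((E.minimal 𝒪[F]).integralModel 𝒪[F]).c₄ = 0 from Subtype.ext h0]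
    exact Ideal.zero_mem _
  have hjW : E.j = (E.minimal 𝒪[F]).c₄ ^ 3 * ((E.minimal 𝒪[F]).Δ)⁻¹ := by
    have : (E.minimal 𝒪[F]).j = E.j := by
      change ((E.exists_isMinimal 𝒪[F]).choose • E).j = E.j; exact variableChange_j _ _
    rw [← this, j, Units.val_inv_eq_inv_val, coe_Δ', mul_comm]
  have hj0 : E.j ≠ 0 := by rw [hjW]; exact mul_ne_zero (pow_ne_zero 3 hc40) (inv_ne_zero hΔ0)
  have hn : ‖q * E.j‖ = 1 := by rw [norm_mul, hqn, inv_mul_cancel₀ (norm_ne_zero_iff.mpr hj0)]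
  have hv1 : valuation F (q * E.j) = 1 := by
    refine le_antisymm ((Valuation.mem_integer_iff _ _).mp ((norm_le_one_iff F _).mp hn.le)) ?_
    refine not_lt.mp fun h => ?_
    have := (norm_lt_one_iff F _).mpr h
    rw [hn] at this
    exact lt_irrefl _ this
  have h0 : ord F (q * E.j) = 0 := (ord_eq_zero_iff F (mul_ne_zero hq0 hj0)).mpr hv1
  have hc4o : ord F (E.minimal 𝒪[F]).c₄ = 0 := by rw [hWc₄]; exact ord_eq_zero_of_not_mem hc4
  rw [ord_mul F hq0 hj0, hjW, ord_mul F (pow_ne_zero 3 hc40) (inv_ne_zero hΔ0), ord_pow F hc40,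
    hc4o, ord_inv'' hΔ0] at h0
  omega

/-- **Kodaira type `I_v` reads `v = v(Δ_min)`** for a multiplicative-reduction minimal model
(Tate's algorithm, step 2: Silverman ATAEC IV.9.4; `v ≠ 0` since `I₀` is good reduction).
[cite: SilvermanATAEC1994, IV.9.4 steps 1–2] -/
theorem ord_Δ_eq_of_kodairaSymbol_eq_I (E : WeierstrassCurve F) [E.IsElliptic]
    (hmult : (E.minimal 𝒪[F]).HasMultiplicativeReduction 𝒪[F]) {v : ℕ}
    (hv : E.kodairaSymbol 𝒪[F] = .I v) : v ≠ 0 ∧ ord F (E.minimal 𝒪[F]).Δ = v := by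
  haveI : (E.minimal 𝒪[F]).IsMinimal 𝒪[F] := hmult.toIsMinimal
  haveI hWe : (E.minimal 𝒪[F]).IsElliptic := by
    change ((E.exists_isMinimal 𝒪[F]).choose • E).IsElliptic; infer_instance
  have hv0 : v ≠ 0 := by
    rintro rfl
    exact hmult.not_hasGoodReduction 𝒪[F] ((kodairaSymbol_eq_I_zero_iff (R := 𝒪[F]) E).mp hv)
  refine ⟨hv0, ?_⟩
  set I := (E.minimal 𝒪[F]).integralModel 𝒪[F] with hI
  have hk : I.kodairaSymbolOfMinimal = .I v := hv
  rw [kodairaSymbolOfMinimal_eq_I_iff I hv0] at hk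
  obtain ⟨-, -, hval⟩ := hk
  have hΔ0 : I.Δ ≠ 0 := by
    intro h0
    apply (E.minimal 𝒪[F]).isUnit_Δ.ne_zero
    rw [← integralModel_Δ_eq 𝒪[F] (E.minimal 𝒪[F]), ← hI, h0, map_zero]
  obtain ⟨ϖ, hϖ⟩ := IsDiscreteValuationRing.exists_irreducible 𝒪[F]
  obtain ⟨n, u, hn⟩ := IsDiscreteValuationRing.eq_unit_mul_pow_irreducible hΔ0 hϖ
  have hadd : IsDiscreteValuationRing.addVal 𝒪[F] I.Δ = n :=
    IsDiscreteValuationRing.addVal_def I.Δ u hϖ n hn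
  rw [hadd] at hval
  have hnv : n = v := by simpa using hval
  rw [← integralModel_Δ_eq 𝒪[F] (E.minimal 𝒪[F]), ← hI]
  change ord F (I.Δ : F) = v
  rw [ord_coe_eq_of_eq_unit_mul_pow hϖ u hn, hnv]

end Valuation

/-! ## §4 Hilbert 90 and the norm index of a twisted uniformisation -/

section Hilbert90

variable {F : Type u} [Field F] [CharZero F] {K' : IntermediateField F (AlgebraicClosure F)}

/-- **Hilbert's Theorem 90 for the quadratic `K' = F(x)`**: `u·σu = 1` forces `u = w/σw`
(`w = 1 + u` if `u ≠ -1`, `w = x` if `u = -1`). [cite: SerreLocalFields1979, Ch. X §1 Prop. 2] -/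
theorem exists_eq_mul_inv_algEquiv_of_mul_algEquiv_eq_one (h2 : Module.finrank F K' = 2) {d : F}
    (hd : ¬ IsSquare d) {x : K'} (hx : x ^ 2 = algebraMap F K' d) {σ : K' ≃ₐ[F] K'} (hσ : σ ≠ 1)
    (u : (↥K')ˣ) (hu : (u : K') * σ (u : K') = 1) :
    ∃ w : (↥K')ˣ, u = w * (Units.map (σ : K' →* K') w)⁻¹ := by
  have hσx := algEquiv_apply_eq_neg h2 hd hx hσ
  by_cases hu1 : (u : K') = -1
  · have hx0 : x ≠ 0 := by
      rintro rfl
      apply hd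
      refine ⟨0, (algebraMap F K').injective ?_⟩
      rw [← hx, map_mul, map_zero]; ring
    refine ⟨Units.mk0 x hx0, eq_mul_inv_iff_mul_eq.mpr (Units.ext ?_)⟩
    rw [Units.val_mul, Units.coe_map, MonoidHom.coe_coe, Units.val_mk0, hσx, hu1]
    ring
  · have hw0 : (1 : K') + u ≠ 0 := fun h => hu1 (by linear_combination h)
    refine ⟨Units.mk0 _ hw0, eq_mul_inv_iff_mul_eq.mpr (Units.ext ?_)⟩
    rw [Units.val_mul, Units.coe_map, MonoidHom.coe_coe, Units.val_mk0, map_add, map_one]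
    linear_combination hu

end Hilbert90

section Twisted

variable {F : Type u} [Field F] [CharZero F] {K' : IntermediateField F (AlgebraicClosure F)}
  (h2 : Module.finrank F K' = 2) {σ : K' ≃ₐ[F] K'} (hσ : σ ≠ 1) {d : F} (hd : ¬ IsSquare d)
  {x : K'} (hx : x ^ 2 = algebraMap F K' d)
  (E : WeierstrassCurve F) {q : F} (hq0 : q ≠ 0) (hq1 : ∀ n : ℤ, q ^ n = 1 → n = 0)
  (f : Additive (↥K')ˣ →+ (E.baseChange K').toAffine.Point)
  (hfs : Function.Surjective f)
  (hfk : ∀ u : (↥K')ˣ, f (Additive.ofMul u) = 0 ↔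
      ∃ n : ℤ, ((u : K') : K') = algebraMap F K' q ^ n)
  (hft : ∀ u : (↥K')ˣ, Affine.Point.map (W' := E) (σ : K' →ₐ[F] K') (f (Additive.ofMul u)) =
      -f (Additive.ofMul (Units.map (σ : K' →* K') u)))

omit [CharZero F] in
include hfs hfk hft in
/-- **Fixed points of the twisted action**: `E(K')^σ = f({u : u·σu ∈ q^ℤ})` — Kramer's
`I(M) = {z : N z ∈ q^ℤ}` (p. 123). [cite: Kramer1981, §2 (p. 123), I(M)] -/
theorem mem_fixedSubgroup_iff_of_twisted (P : (E.baseChange K').toAffine.Point) :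
    P ∈ fixedSubgroup E K' σ ↔
      ∃ u : (↥K')ˣ, ∃ n : ℤ, f (Additive.ofMul u) = P ∧
        ((u : K') : K') * σ (u : K') = algebraMap F K' q ^ n := by
  have key : ∀ u : (↥K')ˣ, Affine.Point.map (W' := E) (σ : K' →ₐ[F] K') (f (Additive.ofMul u)) =
      f (Additive.ofMul u) ↔ ∃ n : ℤ, ((u : K') : K') * σ (u : K') = algebraMap F K' q ^ n := by
    intro u
    rw [hft, neg_eq_iff_add_eq_zero, ← map_add, ← ofMul_mul, hfk, Units.val_mul, Units.coe_map,
      MonoidHom.coe_coe, mul_comm]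
  rw [mem_fixedSubgroup_iff]
  constructor
  · intro hP
    obtain ⟨w, rfl⟩ := hfs P
    obtain ⟨u, rfl⟩ : ∃ u, Additive.ofMul u = w := ⟨Additive.toMul w, rfl⟩
    obtain ⟨n, hn⟩ := (key u).mp hP
    exact ⟨u, n, rfl, hn⟩
  · rintro ⟨u, n, rfl, hn⟩
    exact (key u).mpr ⟨n, hn⟩

omit [CharZero F] in
include hfs hft in
/-- **Norms under the twisted action**: `N E(K') = f({w/σw})`. [cite: Kramer1981, §2 (p. 123), I(M)] -/
theorem mem_normSubgroup_iff_of_twisted (P : (E.baseChange K').toAffine.Point) :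
    P ∈ normSubgroup E K' σ ↔
      ∃ w : (↥K')ˣ, f (Additive.ofMul (w * (Units.map (σ : K' →* K') w)⁻¹)) = P := by
  have key : ∀ w : (↥K')ˣ, f (Additive.ofMul w) +
      Affine.Point.map (W' := E) (σ : K' →ₐ[F] K') (f (Additive.ofMul w)) =
      f (Additive.ofMul (w * (Units.map (σ : K' →* K') w)⁻¹)) := by
    intro w
    rw [hft, ofMul_mul, ofMul_inv, map_add, map_neg]
  rw [mem_normSubgroup_iff]
  constructor
  · rintro ⟨Q, rfl⟩
    obtain ⟨w, rfl⟩ := hfs Q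
    obtain ⟨u, rfl⟩ : ∃ u, Additive.ofMul u = w := ⟨Additive.toMul w, rfl⟩
    exact ⟨u, (key u).symm⟩
  · rintro ⟨w, rfl⟩
    exact ⟨f (Additive.ofMul w), key w⟩

include h2 hσ hd hx hq0 hq1 hfs hfk hft in
/-- **The key dichotomy**: for `u` with `u·σu = q^n`, `f(u)` is a norm iff `n` is even
(`⟹`: `u = (w/σw)·q^k` up to the kernel, and `N(w/σw) = 1`, `N(q^k) = q^{2k}`; `⟸`: Hilbert 90
applied to `u q^{-n/2}`). [cite: Kramer1981, §2 proof of Prop. 2 (p. 124)] -/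
theorem map_mem_normSubgroup_iff_even {u : (↥K')ˣ} {n : ℤ}
    (hu : ((u : K') : K') * σ (u : K') = algebraMap F K' q ^ n) :
    f (Additive.ofMul u) ∈ normSubgroup E K' σ ↔ Even n := by
  have hqK : algebraMap F K' q ≠ 0 := (_root_.map_ne_zero _).mpr hq0
  rw [mem_normSubgroup_iff_of_twisted E f hfs hft]
  constructor
  · rintro ⟨w, hw⟩
    -- `u = (w/σw) · q^k`
    have h0 : f (Additive.ofMul (u * (w * (Units.map (σ : K' →* K') w)⁻¹)⁻¹)) = 0 := by
      rw [ofMul_mul, ofMul_inv, map_add, map_neg, hw, add_neg_cancel]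
    obtain ⟨k, hk⟩ := (hfk _).mp h0
    simp only [Units.val_mul, Units.val_inv_eq_inv_val, Units.coe_map, MonoidHom.coe_coe,
      mul_inv_rev, inv_inv] at hk
    -- take norms: `q^n = q^{2k}`
    have hw0 : ((w : K') : K') ≠ 0 := w.ne_zero
    have hσw0 : σ ((w : K') : K') ≠ 0 := by
      intro h; exact hw0 (by simpa using congrArg σ.symm h)
    have hN : algebraMap F K' q ^ n = (algebraMap F K' q ^ k) ^ 2 := by
      have e : ((u : K') : K') = algebraMap F K' q ^ k * (w : K') * (σ (w : K'))⁻¹ := by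
        rw [← hk]; field_simp
      rw [← hu, e, map_mul, map_mul, map_inv₀, map_zpow₀, AlgEquiv.commutes,
        algEquiv_algEquiv_apply h2 hd hx hσ]
      field_simp
    have hq : q ^ n = q ^ (2 * k) := by
      apply (algebraMap F K').injective
      rw [map_zpow₀, map_zpow₀, hN, ← zpow_natCast, ← zpow_mul, Nat.cast_ofNat, mul_comm]
    have hnk : n = 2 * k := by
      have h1 : q ^ (n - 2 * k) = 1 := by
        rw [zpow_sub₀ hq0, hq, div_self (zpow_ne_zero _ hq0)]
      have := hq1 _ h1
      omega
    exact ⟨k, by rw [hnk]; ring⟩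
  · rintro ⟨k, rfl⟩
    -- `v = u q^{-k}` has `N v = 1`
    set qK : (↥K')ˣ := Units.mk0 (algebraMap F K' q) hqK with hqKdef
    have hvval : (((u * (qK ^ k)⁻¹ : (↥K')ˣ)) : K') = (u : K') * (algebraMap F K' q ^ k)⁻¹ := by
      rw [Units.val_mul, Units.val_inv_eq_inv_val, Units.val_zpow_eq_zpow_val, hqKdef, Units.val_mk0]
    have hv : (((u * (qK ^ k)⁻¹ : (↥K')ˣ)) : K') * σ (((u * (qK ^ k)⁻¹ : (↥K')ˣ)) : K') = 1 := by
      rw [hvval, map_mul, map_inv₀, map_zpow₀, AlgEquiv.commutes]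
      calc ((u : K') : K') * (algebraMap F K' q ^ k)⁻¹ * (σ (u : K') * (algebraMap F K' q ^ k)⁻¹)
          = ((u : K') * σ (u : K')) * ((algebraMap F K' q ^ k)⁻¹ * (algebraMap F K' q ^ k)⁻¹) := by
            ring
        _ = 1 := by
            rw [hu, zpow_add₀ hqK]
            field_simp
    obtain ⟨w, hw⟩ := exists_eq_mul_inv_algEquiv_of_mul_algEquiv_eq_one h2 hd hx hσ _ hv
    refine ⟨w, ?_⟩
    rw [← hw, ofMul_mul, ofMul_inv, map_add, map_neg]
    have hk0 : f (Additive.ofMul (qK ^ k)) = 0 :=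
      (hfk _).mpr ⟨k, by rw [Units.val_zpow_eq_zpow_val, hqKdef, Units.val_mk0]⟩
    rw [hk0, neg_zero, add_zero]

include h2 hσ hd hx hq0 hq1 hfs hfk hft in
/-- **`i(K/F) = 0` when only even powers of `q` are norms from `I`**: if every `u` with
`u·σu = q^n` has `n` even, then `E(K')^σ ⊆ N E(K')`, i.e. the norm index is `1`.
[cite: Kramer1981, §2 Prop. 2 (a) (p. 123), v(Δ) odd] -/
theorem relIndex_eq_one_of_twisted
    (hodd : ∀ (u : (↥K')ˣ) (n : ℤ), ((u : K') : K') * σ (u : K') = algebraMap F K' q ^ n → Even n) :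
    (normSubgroup E K' σ).relIndex (fixedSubgroup E K' σ) = 1 := by
  rw [AddSubgroup.relIndex_eq_one]
  intro P hP
  obtain ⟨u, n, rfl, hn⟩ := (mem_fixedSubgroup_iff_of_twisted E f hfs hfk hft P).mp hP
  exact (map_mem_normSubgroup_iff_even h2 hσ hd hx E hq0 hq1 f hfs hfk hft hn).mpr (hodd u n hn)

include h2 hσ hd hx hq0 hq1 hfs hfk hft in
/-- **`i(K/F) = 1` when `q` itself is a norm from `K'`**: if `q = w·σw` then `f(w)` is a
`σ`-fixed point which is not a norm, and `P ↦ parity of n` (`P = f(u)`, `u·σu = q^n`) identifies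
`E(K')^σ / N E(K')` with `ℤ/2`. [cite: Kramer1981, §2 Prop. 2 (a) (p. 123), v(Δ) even] -/
theorem relIndex_eq_two_of_twisted (w : (↥K')ˣ)
    (hw : ((w : K') : K') * σ (w : K') = algebraMap F K' q) :
    (normSubgroup E K' σ).relIndex (fixedSubgroup E K' σ) = 2 := by
  have hw1 : ((w : K') : K') * σ (w : K') = algebraMap F K' q ^ (1 : ℤ) := by rw [zpow_one, hw]
  have hwfix : f (Additive.ofMul w) ∈ fixedSubgroup E K' σ :=
    (mem_fixedSubgroup_iff_of_twisted E f hfs hfk hft _).mpr ⟨w, 1, rfl, hw1⟩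
  rw [AddSubgroup.relIndex, AddSubgroup.index_eq_two_iff]
  refine ⟨⟨f (Additive.ofMul w), hwfix⟩, fun P => ?_⟩
  obtain ⟨u, n, hu, hn⟩ := (mem_fixedSubgroup_iff_of_twisted E f hfs hfk hft (P : _)).mp P.2
  have hun : (((u * w : (↥K')ˣ)) : K') * σ (((u * w : (↥K')ˣ)) : K') =
      algebraMap F K' q ^ (n + 1) := by
    rw [Units.val_mul, map_mul, zpow_add₀ ((_root_.map_ne_zero _).mpr hq0), zpow_one, ← hn, ← hw]
    ring
  have h1 : (P + ⟨f (Additive.ofMul w), hwfix⟩ : fixedSubgroup E K' σ) ∈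
      (normSubgroup E K' σ).addSubgroupOf (fixedSubgroup E K' σ) ↔ Even (n + 1) := by
    rw [AddSubgroup.mem_addSubgroupOf, AddSubgroup.coe_add, ← hu, ← map_add, ← ofMul_mul]
    exact map_mem_normSubgroup_iff_even h2 hσ hd hx E hq0 hq1 f hfs hfk hft hun
  have h2' : P ∈ (normSubgroup E K' σ).addSubgroupOf (fixedSubgroup E K' σ) ↔ Even n := by
    rw [AddSubgroup.mem_addSubgroupOf, ← hu]
    exact map_mem_normSubgroup_iff_even h2 hσ hd hx E hq0 hq1 f hfs hfk hft hn
  rw [h1, h2', Int.even_add_one]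
  rcases Int.even_or_odd n with h | h
  · exact Or.inr ⟨h, not_not.mpr h⟩
  · exact Or.inl ⟨Int.not_even_iff_odd.mpr h, Int.not_even_iff_odd.mpr h⟩

end Twisted

/-! ## §5 Proposition 2 (a) and the discharge of `props1_2a_multiplicativeNormIndex` -/

section Prop2a

open LocalWeilDatum

variable {F : Type} [Field F] [ValuativeRel F] [TopologicalSpace F] [IsNonarchimedeanLocalField F]

/-- `ord (t⁻¹) = - ord t`. [folklore] -/
private theorem ord_inv₃ {t : F} (ht : t ≠ 0) : ord F t⁻¹ = -ord F t := by
  have h := ord_mul F (inv_ne_zero ht) ht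
  rw [inv_mul_cancel₀ ht, ord_one] at h
  omega

/-- `ord (t ^ k) = k · ord t` for `k ∈ ℤ`. [folklore] -/
private theorem ord_zpow₃ {t : F} (ht : t ≠ 0) (k : ℤ) : ord F (t ^ k) = k * ord F t := by
  cases k with
  | ofNat n => rw [Int.ofNat_eq_natCast, zpow_natCast, ord_pow F ht]
  | negSucc n =>
      rw [zpow_negSucc, ord_inv₃ (pow_ne_zero _ ht), ord_pow F ht, Int.negSucc_eq]
      push_cast
      ring

variable [CharZero F] {K' : IntermediateField F (AlgebraicClosure F)}

omit [ValuativeRel F] [TopologicalSpace F] [IsNonarchimedeanLocalField F] [CharZero F] in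
/-- **Norms from `K' = F(x)` are the values of `s² - d t²`**: `t ∈ F^×` is `u·σu` for some
`u ∈ K'^×` iff `t ∈ quadraticNormSubgroup F d` (Kramer p. 123, "field-theoretic norm").
[cite: Kramer1981, §2 (p. 123), field-theoretic norm] -/
theorem exists_mul_algEquiv_eq_iff_mem_quadraticNormSubgroup (h2 : Module.finrank F K' = 2)
    {d : F} (hd : ¬ IsSquare d) {x : K'} (hx : x ^ 2 = algebraMap F K' d) {σ : K' ≃ₐ[F] K'}
    (hσ : σ ≠ 1) (t : Fˣ) :
    (∃ u : (↥K')ˣ, ((u : K') : K') * σ (u : K') = algebraMap F K' (t : F)) ↔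
      t ∈ quadraticNormSubgroup F d := by
  constructor
  · rintro ⟨u, hu⟩
    obtain ⟨s, y, hsy⟩ := exists_mul_algEquiv_eq h2 hd hx hσ (u : K')
    exact ⟨s, y, (algebraMap F K').injective (by rw [← hsy, hu])⟩
  · rintro ⟨s, y, hsy⟩
    set w : K' := algebraMap F K' s + algebraMap F K' y * x with hw
    have hN : w * σ w = algebraMap F K' (t : F) := by
      rw [hw, add_mul_mul_algEquiv h2 hd hx hσ, hsy]
    have hw0 : w ≠ 0 := by
      intro h0
      apply t.ne_zero
      apply (algebraMap F K').injective
      rw [← hN, h0, zero_mul, map_zero]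
    exact ⟨Units.mk0 w hw0, by rw [Units.val_mk0]; exact hN⟩

/-- **Kramer 1981, Proposition 2 (a)** (clause (2) of `props1_2a_multiplicativeNormIndex`):
for `E/F` whose minimal model has non-split multiplicative reduction and `K' = F(√d)` the
unramified quadratic extension, the norm index `[E(K')^σ : N E(K')]` is `1` if `v(Δ_min)` is odd
and `2` if it is even ("`i(K/F)` is `0` or `1` according to whether `v(Δ)` is odd or even",
p. 123). Proof as printed: `E(K') ≅ K'^×/q^ℤ` with `σ` acting through `u ↦ (σu)⁻¹` (the twisted
Tate curve, `exists_twistedUniformizer`), so `E(K')^σ = I/q^ℤ`, `I = {u : u·σu ∈ q^ℤ}`, and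
`N E(K')` is the image of `{w/σw} = ker N` (Hilbert 90); the quotient is detected by the parity of
`n` in `u·σu = q^n`, and `q^n` is a norm from the unramified `K'` iff `n·v(q) = n·v(Δ)` is even.
[cite: Kramer1981, §2 Prop. 2 (a) (p. 123)] -/
theorem prop2a_unramifiedNormIndex :
    ∀ (F : Type) [Field F] [ValuativeRel F] [TopologicalSpace F] [IsNonarchimedeanLocalField F]
      [CharZero F] (E : WeierstrassCurve F) [E.IsElliptic]
      (K' : IntermediateField F (AlgebraicClosure F)) (_h2 : Module.finrank F K' = 2)
      (σ : K' ≃ₐ[F] K') (_hσ : σ ≠ 1) (d : F) (_hd : ¬ IsSquare d) (x : K')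
      (_hx : x ^ 2 = algebraMap F K' d),
      (E.minimal 𝒪[F]).HasMultiplicativeReduction 𝒪[F] →
        ¬ (E.minimal 𝒪[F]).HasSplitMultiplicativeReduction 𝒪[F] → K' ≤ maxUnramified F →
        ∀ v : ℕ, E.kodairaSymbol 𝒪[F] = .I v →
          (Odd v → (normSubgroup E K' σ).relIndex (fixedSubgroup E K' σ) = 1) ∧
            (Even v → (normSubgroup E K' σ).relIndex (fixedSubgroup E K' σ) = 2) := by
  intro F _ _ _ _ _ E _ K' h2 σ hσ d hd x hx hmult hns hK v hv
  letI := nontriviallyNormedField F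
  have hj := one_lt_norm_j_of_minimal_hasMultiplicativeReduction E hmult
  obtain ⟨q, hq0, hq, hqj, hqn⟩ := exists_tateParameter_of_minimal_hasMultiplicativeReduction E hmult
  have hγ := isSquare_gamma_of_le_maxUnramified E hmult hK h2 hd hx
  obtain ⟨f, hfs, hfk, hft⟩ := exists_twistedUniformizer E hns hj hq0 hq hqj K' h2 σ hσ hd hx hγ
  have hq1 : ∀ n : ℤ, q ^ n = 1 → n = 0 := by
    intro n hn
    have h := congrArg (fun z : F => ‖z‖) hn
    simp only [norm_zpow, norm_one] at h
    have h' : ‖q‖ ^ n = ‖q‖ ^ (0 : ℤ) := by rw [h, zpow_zero]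
    exact zpow_right_injective₀ (norm_pos_iff.mpr hq0) hq.ne h'
  obtain ⟨hv0, hvΔ⟩ := ord_Δ_eq_of_kodairaSymbol_eq_I E hmult hv
  have hordq : ord F q = v := by rw [ord_tateParameter_eq_ord_Δ E hmult hq0 hqn, hvΔ]
  -- `q^n` is a norm from `K'` iff `n·v` is even
  have hnorm : ∀ n : ℤ, (∃ u : (↥K')ˣ, ((u : K') : K') * σ (u : K') = algebraMap F K' q ^ n) ↔
      (2 : ℤ) ∣ n * v := by
    intro n
    have e : algebraMap F K' q ^ n = algebraMap F K' (((Units.mk0 q hq0 ^ n : Fˣ)) : F) := by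
      rw [Units.val_zpow_eq_zpow_val, Units.val_mk0, map_zpow₀]
    rw [e, exists_mul_algEquiv_eq_iff_mem_quadraticNormSubgroup h2 hd hx hσ,
      mem_quadraticNormSubgroup_iff_two_dvd_ord hK h2 hd hx hσ, Units.val_zpow_eq_zpow_val,
      Units.val_mk0, ord_zpow₃ hq0, hordq]
  constructor
  · rintro ⟨m, hm⟩
    refine relIndex_eq_one_of_twisted h2 hσ hd hx E hq0 hq1 f hfs hfk hft fun u n hn => ?_
    obtain ⟨c, hc⟩ := (hnorm n).mp ⟨u, hn⟩
    refine ⟨c - n * m, ?_⟩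
    have hc' : (n : ℤ) * (2 * m + 1 : ℕ) = 2 * c := by rw [← hm]; exact hc
    push_cast at hc'
    linarith
  · rintro ⟨m, hm⟩
    obtain ⟨w, hw⟩ := (hnorm 1).mpr ⟨m, by rw [hm]; push_cast; ring⟩
    rw [zpow_one] at hw
    exact relIndex_eq_two_of_twisted h2 hσ hd hx E hq0 hq1 f hfs hfk hft w hw

/-- **Discharge of `Kramer1981.props1_2a_multiplicativeNormIndex`** (Kramer 1981, §2,
Propositions 1 and 2 (a), p. 123): clause (1) is `prop1_splitMultiplicativeNormIndex`
(`SplitMultiplicativeNormIndexProofs`), clause (2) is `prop2a_unramifiedNormIndex`.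
[cite: Kramer1981, §2 Props. 1 and 2 (a) (p. 123)] -/
theorem props1_2a_multiplicativeNormIndex_holds : props1_2a_multiplicativeNormIndex :=
  fun F _ _ _ _ _ E _ K' h2 σ hσ d hd x hx =>
    ⟨prop1_splitMultiplicativeNormIndex F E K' h2 σ hσ d hd x hx,
      prop2a_unramifiedNormIndex F E K' h2 σ hσ d hd x hx⟩

end Prop2a

end Literature.NumberTheory.EllipticCurves.Kramer1981

end
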